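import Mathlib
import Literature.NumberTheory.EllipticCurves.IwasawaAlgebraCharIdealProofs
import HarnessLib

/-!
# Non-square descent — RING-SIDE DISCHARGES OVER `Λ' = 𝒪⟦X⟧` FOR THE DERIVED CERTIFICATE INPUTS (prime `ϖ`, finite multiplicity,
# reduction map `𝒪⟦X⟧ → k⟦X⟧`, compatible `k⟦X⟧`-structure on `E/ϖE`) — seed crux `SignedMuSeedAtTwoPlus` stmt-BirchSwinnertonDyer-21438
# (parent Kμ⁺ `SignedMuVanishingAtTwoPlus` stmt-BirchSwinnertonDyer-20689, route ResidualThetaTransportAtTwo), line `nonsquare-descent`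

Cell `bsd-wall`, width seat `bsd-wall-rtt-p4-w2` g18 (`--supports`, closes nothing).  THEOREMS ONLY; BSD is not proved by this and
nothing arithmetic is asserted: power-series ring algebra.

The derived inputs `rank_le_one_modP_of_injective` (`Theorems/…NonsquareDescentRankOneModP.lean`) and
`exists_nonTorsion_modP_of_ringHom` (`…RankOneNonTorsion.lean`) are stated over an abstract ring `R`, an element `ϖ` and a ring map
`φ : R →+* S`, with side conditions: `ϖ` PRIME, every non-zero element of finite `ϖ`-multiplicity, `φ` surjective with `φ r = 0 ↔ ϖ ∣ r`,
and an `S`-module structure on `V` compatible with the `R`-structure.  This file discharges them for the ring of the line card,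
`R = Λ' = 𝒪⟦X⟧` with `ϖ ∈ 𝒪` (the card: `𝒪 = ℤ₂[ζ₃]`, `ϖ = 2`, `S = 𝔽₄⟦X⟧`):

* §1 `finiteMultiplicity_C` — if non-zero elements of `𝒪` have finite `ϖ`-multiplicity, non-zero power series have finite
  `C ϖ`-multiplicity (read it on a non-zero coefficient).  (`Prime (C ϖ)` for `ϖ` prime is the tree theorem
  `Literature.NumberTheory.EllipticCurves.prime_C_of_prime`, cited not restated; `prime_C_and_finiteMultiplicity` packages both.)
* §2 `map_eq_zero_iff_C_dvd` — for `φ₀ : 𝒪 →+* k` with `φ₀ a = 0 ↔ ϖ ∣ a`, the coefficientwise map `PowerSeries.map φ₀ : 𝒪⟦X⟧ → k⟦X⟧`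
  kills exactly the multiples of `C ϖ`; it is surjective when `φ₀` is (Mathlib `PowerSeries.map_surjective`);
  `quotientMk_eq_zero_iff_dvd` — the instance `φ₀ = 𝒪 → 𝒪/(ϖ)`.
* §3 **`exists_module_compatible`** — for ANY surjective ring map `φ : R →+* S` killing exactly the multiples of `ϖ` and any `R`-module `V`
  killed by `ϖ` (`V = E/ϖE`), there EXISTS an `S`-module structure on `V` with `r • v = φ r • v` (existential — no definition is
  introduced): the hypothesis `hcompat` of the derived inputs is always satisfiable, canonically.

[folklore]
-/

set_option autoImplicit false
-- the Theorems namespace of this sub repeats the summit name by design (D-0017 nested layout)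
set_option linter.dupNamespace false

open scoped Pointwise

namespace Summit.BirchSwinnertonDyer.BirchSwinnertonDyer.Theorems.SignedMuAtTwo.NonsquareDescent

/-! ## §1 Finite `C ϖ`-multiplicity in `𝒪⟦X⟧` -/

section Multiplicity

variable {A : Type*} [CommRing A]

/-- `(C ϖ)ⁿ ∣ f` forces `ϖⁿ ∣` every coefficient of `f`. [folklore] -/
theorem pow_dvd_coeff_of_C_pow_dvd {ϖ : A} {n : ℕ} {f : PowerSeries A}
    (h : (PowerSeries.C ϖ : PowerSeries A) ^ n ∣ f) (i : ℕ) : ϖ ^ n ∣ PowerSeries.coeff i f := by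
  obtain ⟨g, rfl⟩ := h
  rw [← map_pow, PowerSeries.coeff_C_mul]
  exact dvd_mul_right _ _

/-- **Finite `C ϖ`-multiplicity of non-zero power series** from finite `ϖ`-multiplicity of non-zero scalars (read on a non-zero
coefficient): the hypothesis `hfin` of `rank_le_one_modP` / `exists_nonTorsion_modP` for `R = 𝒪⟦X⟧`. [folklore] -/
theorem finiteMultiplicity_C {ϖ : A} (hfin : ∀ a : A, a ≠ 0 → FiniteMultiplicity ϖ a)
    (f : PowerSeries A) (hf : f ≠ 0) : FiniteMultiplicity (PowerSeries.C ϖ : PowerSeries A) f := by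
  have hex : ∃ i, PowerSeries.coeff i f ≠ 0 := by
    by_contra h
    push Not at h
    exact hf (PowerSeries.ext fun i => by rw [h i, map_zero])
  obtain ⟨i, hi⟩ := hex
  obtain ⟨n, hn⟩ := hfin _ hi
  exact ⟨n, fun h => hn (pow_dvd_coeff_of_C_pow_dvd h i)⟩

/-- The same in the spelling `∃ n, ¬ (C ϖ)ⁿ ∣ f` used by `rank_le_one_modP`. [folklore] -/
theorem exists_not_C_pow_dvd {ϖ : A} (hfin : ∀ a : A, a ≠ 0 → FiniteMultiplicity ϖ a)
    (f : PowerSeries A) (hf : f ≠ 0) : ∃ n : ℕ, ¬ (PowerSeries.C ϖ : PowerSeries A) ^ n ∣ f := by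
  obtain ⟨n, hn⟩ := finiteMultiplicity_C hfin f hf
  exact ⟨n + 1, hn⟩

/-- In a domain with descending-chain condition on divisibility (`WfDvdMonoid`, e.g. any Noetherian domain, `ℤ_[p]`, `ℤ₂[ζ₃]`),
every non-zero element has finite `ϖ`-multiplicity for a prime `ϖ` (Mathlib `FiniteMultiplicity.of_prime_left`). [folklore] -/
theorem finiteMultiplicity_of_prime [IsDomain A] [WfDvdMonoid A] {ϖ : A} (hϖ : Prime ϖ)
    (a : A) (ha : a ≠ 0) : FiniteMultiplicity ϖ a :=
  FiniteMultiplicity.of_prime_left hϖ ha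

/-- Package: for `ϖ` prime in a domain `𝒪` with `WfDvdMonoid 𝒪`, `C ϖ` is prime in `𝒪⟦X⟧` (tree theorem
`Literature.NumberTheory.EllipticCurves.prime_C_of_prime`) and non-zero power series have finite `C ϖ`-multiplicity — the ring
hypotheses `hϖ`, `hfin` of `exists_nonTorsion_modP_of_ringHom` for `R = 𝒪⟦X⟧`. [folklore] -/
theorem prime_C_and_finiteMultiplicity [IsDomain A] [WfDvdMonoid A] {ϖ : A} (hϖ : Prime ϖ) :
    Prime (PowerSeries.C ϖ : PowerSeries A) ∧
      ∀ f : PowerSeries A, f ≠ 0 → FiniteMultiplicity (PowerSeries.C ϖ : PowerSeries A) f :=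
  ⟨Literature.NumberTheory.EllipticCurves.prime_C_of_prime hϖ,
    finiteMultiplicity_C (finiteMultiplicity_of_prime hϖ)⟩

end Multiplicity

/-! ## §2 The reduction map `𝒪⟦X⟧ → k⟦X⟧` kills exactly `(C ϖ)` -/

section Reduction

variable {A : Type*} [CommRing A] {k : Type*} [CommRing k]

/-- **`PowerSeries.map φ₀ f = 0 ↔ C ϖ ∣ f`** when `φ₀ : 𝒪 →+* k` kills exactly the multiples of `ϖ`: the hypothesis `hφ` of
`rank_le_one_modP_of_ringHom` / `exists_nonTorsion_modP_of_ringHom` for `φ = PowerSeries.map φ₀ : 𝒪⟦X⟧ → k⟦X⟧`. [folklore] -/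
theorem map_eq_zero_iff_C_dvd (φ₀ : A →+* k) {ϖ : A} (hker : ∀ a : A, φ₀ a = 0 ↔ ϖ ∣ a) (f : PowerSeries A) :
    PowerSeries.map φ₀ f = 0 ↔ (PowerSeries.C ϖ : PowerSeries A) ∣ f := by
  constructor
  · intro h
    have hc : ∀ i, ∃ b : A, PowerSeries.coeff i f = ϖ * b := fun i => by
      have h1 : φ₀ (PowerSeries.coeff i f) = 0 := by rw [← PowerSeries.coeff_map, h, map_zero]
      exact (hker _).mp h1
    choose b hb using hc
    refine ⟨PowerSeries.mk b, PowerSeries.ext fun i => ?_⟩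
    rw [PowerSeries.coeff_C_mul, PowerSeries.coeff_mk, hb]
  · rintro ⟨g, rfl⟩
    rw [map_mul, PowerSeries.map_C, (hker ϖ).mpr (dvd_refl ϖ), map_zero, zero_mul]

/-- The reduction map is surjective when `φ₀` is (Mathlib `PowerSeries.map_surjective`): the hypothesis `hφs`. [folklore] -/
theorem map_surjective_of_surjective (φ₀ : A →+* k) (h : Function.Surjective φ₀) :
    Function.Surjective (PowerSeries.map φ₀) :=
  PowerSeries.map_surjective φ₀ h

/-- The instance `φ₀ = 𝒪 → 𝒪/(ϖ)`: `Ideal.Quotient.mk (span {ϖ}) a = 0 ↔ ϖ ∣ a`, and it is surjective. [folklore] -/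
theorem quotientMk_eq_zero_iff_dvd (ϖ a : A) :
    Ideal.Quotient.mk (Ideal.span {ϖ}) a = 0 ↔ ϖ ∣ a := by
  rw [Ideal.Quotient.eq_zero_iff_mem, Ideal.mem_span_singleton]

/-- Hence `PowerSeries.map (𝒪 → 𝒪/(ϖ))` is a surjection `𝒪⟦X⟧ → (𝒪/ϖ)⟦X⟧` killing exactly `(C ϖ)`. [folklore] -/
theorem map_quotientMk_eq_zero_iff_and_surjective (ϖ : A) :
    (∀ f : PowerSeries A, PowerSeries.map (Ideal.Quotient.mk (Ideal.span {ϖ})) f = 0 ↔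
        (PowerSeries.C ϖ : PowerSeries A) ∣ f) ∧
      Function.Surjective (PowerSeries.map (Ideal.Quotient.mk (Ideal.span {ϖ}))) :=
  ⟨map_eq_zero_iff_C_dvd _ (quotientMk_eq_zero_iff_dvd ϖ),
    map_surjective_of_surjective _ Ideal.Quotient.mk_surjective⟩

end Reduction

/-! ## §3 A compatible `S`-module structure on `E/ϖE` always exists -/

section Compatible

variable {R : Type*} [CommRing R] {S : Type*} [CommRing S] {V : Type*} [AddCommGroup V] [Module R V]

/-- **The hypothesis `hcompat` is satisfiable.**  For a surjective ring map `φ : R →+* S` with `φ r = 0 ↔ ϖ ∣ r` and an `R`-module `V`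
killed by `ϖ` (e.g. `V = E ⧸ ϖE`), there EXISTS an `S`-module structure on `V` with `r • v = φ r • v` for all `r`, `v` (the
`R`-structure factors through `φ`; built with Mathlib's `Function.Surjective.moduleLeft` from a set-theoretic section of `φ` — stated
existentially, so no definition enters the tree). [folklore] -/
theorem exists_module_compatible (φ : R →+* S) (hφs : Function.Surjective φ) {ϖ : R}
    (hφ : ∀ r : R, φ r = 0 ↔ ϖ ∣ r) (hV : ∀ v : V, ϖ • v = 0) :
    ∃ _ : Module S V, ∀ (r : R) (v : V), r • v = φ r • v := by
  classical
  obtain ⟨sec, hsec⟩ : ∃ sec : S → R, ∀ s, φ (sec s) = s := ⟨fun s => Classical.choose (hφs s),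
    fun s => Classical.choose_spec (hφs s)⟩
  let inst : SMul S V := ⟨fun s v => sec s • v⟩
  have hcomp : ∀ (c : R) (x : V), φ c • x = c • x := by
    intro c x
    show sec (φ c) • x = c • x
    have h0 : φ (sec (φ c) - c) = 0 := by rw [map_sub, hsec, sub_self]
    obtain ⟨t, ht⟩ := (hφ _).mp h0
    rw [← sub_eq_zero, ← sub_smul, ht, mul_comm, mul_smul, hV, smul_zero]
  exact ⟨Function.Surjective.moduleLeft φ hφs hcomp, fun r v => (hcomp r v).symm⟩

/-- `V = E ⧸ ϖE` is killed by `ϖ`. [folklore] -/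
theorem smul_mkQ_eq_zero {E : Type*} [AddCommGroup E] [Module R E] (ϖ : R)
    (v : E ⧸ (ϖ • (⊤ : Submodule R E))) : ϖ • v = 0 := by
  obtain ⟨e, rfl⟩ := Submodule.mkQ_surjective _ v
  rw [Submodule.mkQ_apply, ← Submodule.Quotient.mk_smul, Submodule.Quotient.mk_eq_zero]
  exact Submodule.smul_mem_pointwise_smul e ϖ ⊤ Submodule.mem_top

/-- Hence `E ⧸ ϖE` carries SOME `S`-module structure compatible with `φ` (for the card: `V_∞ = Ē^χ/2Ē^χ` is canonically an
`𝔽₄⟦T⟧`-module, the structure in which the S3 (c) certificate is stated). [folklore] -/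
theorem exists_module_compatible_mkQ {E : Type*} [AddCommGroup E] [Module R E]
    (φ : R →+* S) (hφs : Function.Surjective φ) (ϖ : R) (hφ : ∀ r : R, φ r = 0 ↔ ϖ ∣ r) :
    ∃ _ : Module S (E ⧸ (ϖ • (⊤ : Submodule R E))),
      ∀ (r : R) (v : E ⧸ (ϖ • (⊤ : Submodule R E))), r • v = φ r • v :=
  exists_module_compatible φ hφs hφ (smul_mkQ_eq_zero ϖ)

end Compatible

end Summit.BirchSwinnertonDyer.BirchSwinnertonDyer.Theorems.SignedMuAtTwo.NonsquareDescent
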